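import Summits.QuantumFields.YangMills.Theorems.BalabanUVNodesN11OldBranchIntegrableOfDominated

/-!
# DAG node N11 — THE A-FIBRE DOMINATION ROW OF THE NO-EXPANSION 𝐓-STEP AT THE CERTIFICATE `rePinH θ`, ALL-SMALL BRANCH: it HOLDS exactly at the regions
# covered by the ∼2-stars of their own χ_{j+1}-cubes (dag-n11-d's (n2), the covering DISPLAYED), in particular on the whole no-large-field sub-diagonal, and —
# LOCATED, KERNEL-CHECKED — it FAILS at every region with a free bond (so there the VALUE of the residual's `quad` must be [I]'s Gaussian)

HEADER — WORK-UNIT METADATA.  Cell `pub-ymgap`, YM-PLAN Track A (HUMAN RULING D-0062 ∕ D-0149 width seats, director-ym №197), seat `pub-ymgap-dag-n11-w1` (g0; WIDTH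
SEAT 1 of 4 on NODE n11 [B14]), route `BalabanUVNodes` rev 25, item K1⁷ `StabilityBAtRecordR13SepCoPH` = stmt-QuantumFields-20542 (helper, `--kind proof --supports 20542
--as helper`, count-neutral).  [III] = [Balaban1988Convergent], [I] = [Balaban1987RG1].  Over dag-n11-d g10's `…N11OldBranchIntegrableOfDominated` (★★★
`exists_local_witness_clause_succ_rePinH_of_sLaw₁₃CoPH_of_dominated`: residue {A-FIBRE DOMINATION (node00-def-K0b's row), operand rows (def-T)}; HANDOFF §g10 NEXT (n2)),
dag-n11-e g14's `…N11NoExpansionTStepAtRePinH` (the rows as `hrows`), 12a `Node00.TkWeightsOfRecord` (`chiAW`, `chiSmallAW`, `bondsStarW`), 11a `Node00.TkOfRecord`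
(`TkWeights.w = χ_A·e^{−½quad}`), `…N11RePinnedParamDefs` (`rePinH`, `quad ≡ 0`).  Sibling (disjoint): dag-n11-w4's coercivity supplier at a generic `θ`.

THE ROW (verbatim the hypothesis of dag-n11-d's ★★★ ∕ dag-n11-e's `hrows`; history `s′` of length `k+1`, old branch `S`, generation `j`, `Y_j := Λ_{j+1}(init s′)ᶜ ∩
Ω_{j+1}(init s′)`, `B_j :=` the level-`j` bonds in `Y_j`):  `∃ ŵ : (B_j → 𝔰𝔲(N)) → ℝ≥0∞, Measurable ŵ ∧ ∫⁻ ŵ d(⊗_{B_j} Lebesgue) ≠ ⊤ ∧ ∀ ω, ofReal (w_j(Λ_{j+1}, Y_j,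
S_{j+1})(ω)) ≤ ŵ (A_j|B_j)`, `w = χ_A(Y,S)·exp(−½·quad_j(Λ_{j+1}))` ((2.21) p. 258: *«∫ dA_j|_{Z_{j+1}∩Ω_{j+1}∩X} χ(Z_{j+1}∩Ω_{j+1}∩X) exp[−½⟨A_j, C*Δ^{(j)}CA_j⟩ + …]»*).

WHAT THIS FILE PROVES (0 `sorry`, 0 `def`; nothing of Bałaban asserted).
§0 Engines (folklore): `pi_box_eq_top` (one side of infinite measure, no null side ⇒ infinite product mass), `pi_ballBox_ne_top`, `volume_fluctV_univ` (Lebesgue measure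
   of `𝔰𝔲(N) ≅ ℝ^{N²−1}` is infinite, `N ≥ 2`), `not_exists_dominating_of_section` (a weight `≥ 1` on a section over a set of infinite mass has no integrable majorant).
§1 ★★ (n2) POSITIVE: `afibre_dominated_of_cover_of_quad_nonneg` (generic `θ`, [I]'s sign `0 ≤ quad` displayed) ∕ `afibre_dominated_rePinH_of_cover` (certificate): for
   `S_{j+1} = ∅`, IF every bond of `Y_j` lies in the `∼2`-star of some χ_{j+1}-cube `c ⊂ Y_j` (COVERING, displayed) THEN the indicator of the `δ_j`-box on `B_j` (mass
   `Π_b vol(ball δ_j) < ⊤`) dominates: off the box a covered bond is `δ_j`-large, its cube is a (3.16) large-fluctuation cube and `χ^{(j)}(cubes ⊂ Y_j) = 0`.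
§2 ★ `rows_rePinH_of_noLargeField`: on the NO-LARGE-FIELD SUB-DIAGONAL (`Λ_i(s′) = Ω_i(s′)`, `1 ≤ i ≤ k`; contains dag-n11-d's all-large diagonal) every `Y_j = ∅`, the
   A-fibres are one-point spaces and the row holds at the certificate for EVERY `S` and `j` (generalises the first conjunct of their `rows_of_allLarge`).
§3 ★★ LOCATED NEGATIVE, KERNEL-CHECKED (dag-n11-d's LOCATED-QUAD reading, pub-ymgap INBOX l.23933, as a theorem): at `rePinH θ`, `N ≥ 2`, `S_{j+1} = ∅`, the row is
   FALSE as soon as `Y_j` carries a bond in the star of NO χ_{j+1}-cube `⊂ Y_j` (`not_afibre_dominated_rePinH_of_uncovered`, `δ_j > 0`), in particular as soon as `Y_j`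
   contains no χ_{j+1}-cube but a bond (`…_of_noCube`, no sign hypothesis; e.g. a region too thin to contain a χ_{j+1}-cube, whose side `L^{j+2}M₂R_{j+1}` exceeds the
   𝐃_{j+1}-side `L^{j+1}MR_{j+1}` whenever `M < L·M₂` — the witness of record has `M = 1`).  Hence `not_rows_rePinH_of_noCube`: the row FAMILY `∀ S ∈ admSOfRecord,
   ∀ j, ∃ ŵ …` (the hypothesis of dag-n11-e's `noExpansionTStepAt_rePinH_of_dominated_rows` at such an `s′`) is unsatisfiable there (the all-empty branch is an index).
§4 ★★★ `afibre_dominated_rePinH_iff_cover`: at `δ_j > 0`, `N ≥ 2`, the row at the certificate for `S_{j+1} = ∅` ⟺ THE COVERING.  So at the certificate door (d3) reaches,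
   on the all-small branch, exactly the star-covered regions; elsewhere the VALUE of `Zh.quad` must be [I]'s Gaussian.  NOT a claim about print: (2.21) HAS the Gaussian.

HONEST FRAMING.  Helper lane of K1⁷; kernel bookkeeping over accepted declarations; nothing of Bałaban's estimates is asserted; no law of record is edited or posited;
no binder quantifies over all term families.  N11 NOT discharged; K1⁷ NOT closed; counts unmoved (typed 28∕28 · discharged 5∕27).  R4 closes only the conditional
finite-𝕋⁴ rung `BalabanLadder.UV` of one programme at fixed `ε = L^{−K}` — NOT ℝ⁴, NOT OS, NOT a mass gap, NOT Clay.  No `sorry`, `axiom`, `instance`, `notation`.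
Sources (SHAPE only): [III] (2.21) p.258, (2.1) p.254, (3.16) p.268, (3.21) p.269, (3.23) p.270; [I] (1.4)–(1.5) pp.260–261.
-/

noncomputable section

open MeasureTheory
open scoped BigOperators ENNReal NNReal Matrix.Norms.L2Operator

namespace Summit.QuantumFields.YangMills.Theorems.BalabanUVNodesN11AFibreDominationRow

open Literature.MathematicalPhysics.QuantumFieldTheory.Balaban1983to89 T4Continuum Node00 Node00.Tk
open B14.Eq218Concrete (cubesIn mem_cubesIn)
open B14.Eq316 (SmallFluct)
open B10Eq42TorusConstraint (bondsIn mem_bondsIn_iff)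
open BalabanUVNodesN11RePinnedParamDefs

/-! ## §0  Measure-theoretic engines (folklore) -/

section Engines

/-- **A box with one side of infinite measure and no null side has infinite product measure.** [folklore] -/
theorem pi_box_eq_top {ι : Type*} [Fintype ι] {E : Type*} [MeasureSpace E] [SigmaFinite (volume : Measure E)] (t : ι → Set E) {i₀ : ι}
    (h0 : volume (t i₀) = ⊤) (hne : ∀ i, volume (t i) ≠ 0) :
    Measure.pi (fun _ : ι => (volume : Measure E)) (Set.pi Set.univ t) = ⊤ := by
  rw [Measure.pi_pi]
  exact WithTop.prod_eq_top (Finset.mem_univ i₀) h0 fun i _ => hne i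

/-- **A box of balls has finite product measure** on a finite product of proper metric measure spaces. [folklore] -/
theorem pi_ballBox_ne_top {ι : Type*} [Fintype ι] {E : Type*} [PseudoMetricSpace E] [ProperSpace E] [MeasureSpace E]
    [SigmaFinite (volume : Measure E)] [IsFiniteMeasureOnCompacts (volume : Measure E)] (x : E) (r : ℝ) :
    Measure.pi (fun _ : ι => (volume : Measure E)) (Set.pi Set.univ fun _ : ι => Metric.ball x r) ≠ ⊤ := by
  rw [Measure.pi_pi]
  exact WithTop.prod_ne_top fun _ _ => measure_ball_lt_top.ne

variable {N : ℕ} in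
/-- **Lebesgue measure of `𝔰𝔲(N) ≅ ℝ^{N²−1}` is infinite for `N ≥ 2`** (a non-trivial real normed space is not compact; an additive Haar measure of a
non-compact group has infinite mass). [folklore] -/
theorem volume_fluctV_univ (hN : 2 ≤ N) : (volume : Measure (FluctV N)) Set.univ = ⊤ := by
  have hpos : 0 < N ^ 2 - 1 := by
    have h4 : 4 ≤ N ^ 2 := by nlinarith
    omega
  haveI : Nontrivial (FluctV N) := Module.finrank_pos_iff.mp (by rw [finrank_euclideanSpace_fin]; exact hpos)
  exact measure_univ_of_isAddLeftInvariant _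

/-- **THE ABSTRACT OBSTRUCTION**: if a real weight `w` on a space `X` is read through a projection `π : X → (ι → E)` and is `≥ 1` on a section over a measurable
set `T` of infinite product-Lebesgue measure, then `w` has NO measurable majorant `ŵ ∘ π` of finite mass. [folklore] -/
theorem not_exists_dominating_of_section {ι : Type*} [Fintype ι] {E : Type*} [MeasureSpace E] {X : Type*} (w : X → ℝ) (π : X → (ι → E))
    {T : Set (ι → E)} (hT : MeasurableSet T) (hTtop : Measure.pi (fun _ : ι => (volume : Measure E)) T = ⊤)
    (hsec : ∀ a ∈ T, ∃ x, π x = a ∧ 1 ≤ w x) :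
    ¬ ∃ ŵ : (ι → E) → ℝ≥0∞, Measurable ŵ ∧ (∫⁻ a, ŵ a ∂(Measure.pi fun _ : ι => (volume : Measure E))) ≠ ⊤ ∧
        ∀ x, ENNReal.ofReal (w x) ≤ ŵ (π x) := by
  rintro ⟨ŵ, -, hfin, hdom⟩
  have h1 : ∀ a ∈ T, (1 : ℝ≥0∞) ≤ ŵ a := by
    intro a ha
    obtain ⟨x, hx, hw⟩ := hsec a ha
    rw [← hx, ← ENNReal.ofReal_one]
    exact (ENNReal.ofReal_le_ofReal hw).trans (hdom x)
  refine hfin (top_le_iff.mp ?_)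
  calc (⊤ : ℝ≥0∞) = Measure.pi (fun _ : ι => (volume : Measure E)) T := hTtop.symm
    _ = ∫⁻ a, T.indicator 1 a ∂(Measure.pi fun _ : ι => (volume : Measure E)) := (lintegral_indicator_one hT).symm
    _ ≤ ∫⁻ a, ŵ a ∂(Measure.pi fun _ : ι => (volume : Measure E)) := by
        refine lintegral_mono fun a => ?_
        by_cases ha : a ∈ T
        · rw [Set.indicator_of_mem ha]; exact h1 a ha
        · rw [Set.indicator_of_notMem ha]; exact zero_le

end Engines

variable {F : T4Family} {N : ℕ} [NeZero N]

/-! ## §1  ★★ The row for the all-small branch value from the COVERING of the region by the stars of its χ-cubes -/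

section Cover

variable (θ : Stage13HParams F N) (p : B12.RunParams)

/-- Unfolding of the A-weight of the run's 𝐓-weights for a history: `w_j(Λ′, Y, S)(ω) = χ_A(Y, S)(ω) · exp(−½·quad_j(Λ′)(ω))` with 12a's `χ_A` and the history's
residual `quad` (`rfl`). [cite: Balaban1988Convergent, (2.21) p.258, (3.21) p.269 (bookkeeping)] -/
theorem w_WtOfRecord₁₃H_apply {n : ℕ} (s : SeqOfRecord F θ.ν θ.τ9.M (gOfRecord₁₃ F N θ.toStage13Params p) p.K n) (j : ℕ) (Λ' Y S : Set (Site (F.P p.K) 0))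
    (ω : MultiCfg (F.P p.K) (SU N) (FluctV N)) :
    (WtOfRecord₁₃H F N θ p s).w j Λ' Y S ω =
      chiAW F N (FluctV N) θ.ν θ.A₁ p (gOfRecord₁₃ F N θ.toStage13Params p) j Y S ω * Real.exp (-(1 / 2 : ℝ) * (θ.zhAt p s).quad j Λ' ω) := rfl

/-- **12a's `χ_A(Y, ∅)` IS THE (3.16) SMALL-FLUCTUATION INDICATOR OF THE χ_{j+1}-CUBES INSIDE `Y` ALONE** (`𝟙[∅ ⊆ Y] = 1`, `χ^{(j)c}(∅) = χ′(∅) = 1`; def-T's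
`Node00.cubesIn_cubeχ_empty ∕ chiLargeAW_empty ∕ chiPrimeW_empty`). [cite: Balaban1988Convergent, (3.16) p.268, (3.21) p.269] -/
theorem chiAW_empty_eq_chiSmallAW (g : ℕ → ℝ) (j : ℕ) (Y : Set (Site (F.P p.K) 0)) (ω : MultiCfg (F.P p.K) (SU N) (FluctV N)) :
    chiAW F N (FluctV N) θ.ν θ.A₁ p g j Y ∅ ω = chiSmallAW F N (FluctV N) θ.ν θ.A₁ p g j (cubesIn (cubeχ F θ.ν p g j) Y) ω := by
  unfold chiAW
  rw [if_pos (Set.empty_subset Y), one_mul, Set.sdiff_empty, cubesIn_cubeχ_empty, chiLargeAW_empty, chiPrimeW_empty, mul_one, mul_one]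

/-- **★★ THE ROW FOR THE ALL-SMALL BRANCH VALUE FROM THE COVERING, generic `θ` under [I]'s sign `0 ≤ quad`**: at a history `s′` of length `k+1`, generation `j`, branch
value `S_{j+1} = ∅`, IF every level-`j` bond of `Y_j = Λ_{j+1}(init s′)ᶜ ∩ Ω_{j+1}(init s′)` lies in the `∼2`-star `bondsStarW c` of SOME χ_{j+1}-cube `c ⊂ Y_j` (the COVERING of
the region by the stars of its own χ-cubes) and the residual's form is nonnegative, THEN the indicator of the `δ_j`-box `{a : ∀ b ∈ B_j, ‖a b‖ < δ_j}` (finite product-Lebesgue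
mass `Π_b vol(ball δ_j)`) dominates `w_j(Λ_{j+1}, Y_j, ∅)` through `A_j|_{B_j}`: off the box some bond `b ∈ B_j` has `δ_j ≤ ‖A_j(b)‖`, its covering cube is a large-fluctuation
cube of (3.16), so `χ^{(j)}(cubes ⊂ Y_j) = 0`; on the box `w ≤ 1`. [cite: Balaban1988Convergent, (3.16) p.268, (3.21) p.269, (2.21) p.258, (2.1) p.254] -/
theorem afibre_dominated_of_cover_of_quad_nonneg {k : ℕ} (s : SeqOfRecord F θ.ν θ.τ9.M (gOfRecord₁₃ F N θ.toStage13Params p) p.K (k + 1)) (j : ℕ)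
    (hq : ∀ ω : MultiCfg (F.P p.K) (SU N) (FluctV N), 0 ≤ (θ.zhAt p s).quad j (s.init.Λ (j + 1)) ω)
    (hcov : ∀ b ∈ bondsIn j ((s.init.Λ (j + 1))ᶜ ∩ s.init.Ω (j + 1)),
      ∃ c ∈ cubesIn (cubeχ F θ.ν p (gOfRecord₁₃ F N θ.toStage13Params p) j) ((s.init.Λ (j + 1))ᶜ ∩ s.init.Ω (j + 1)),
        b ∈ bondsStarW F θ.ν p (gOfRecord₁₃ F N θ.toStage13Params p) j c)
    (S : ℕ → Set (Site (F.P p.K) 0)) (hS : S (j + 1) = ∅) :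
    ∃ ŵ : (↥(Set.toFinite (bondsIn j ((s.init.Λ (j + 1))ᶜ ∩ s.init.Ω (j + 1)))).toFinset → FluctV N) → ℝ≥0∞, Measurable ŵ ∧
      (∫⁻ a, ŵ a ∂(Measure.pi fun _ : ↥(Set.toFinite (bondsIn j ((s.init.Λ (j + 1))ᶜ ∩ s.init.Ω (j + 1)))).toFinset => (volume : Measure (FluctV N)))) ≠ ⊤ ∧
      ∀ ω, ENNReal.ofReal ((WtOfRecord₁₃H F N θ p s).w j (s.init.Λ (j + 1)) ((s.init.Λ (j + 1))ᶜ ∩ s.init.Ω (j + 1)) (S (j + 1)) ω) ≤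
        ŵ (fun b : ↥(Set.toFinite (bondsIn j ((s.init.Λ (j + 1))ᶜ ∩ s.init.Ω (j + 1)))).toFinset => (ω j).2 b) := by
  classical
  rw [hS]
  set Y := (s.init.Λ (j + 1))ᶜ ∩ s.init.Ω (j + 1) with hY
  set B := (Set.toFinite (bondsIn j Y)).toFinset with hB
  set T : Set (↥B → FluctV N) := Set.pi Set.univ fun _ => Metric.ball (0 : FluctV N) (deltaOfRecord θ.ν (gOfRecord₁₃ F N θ.toStage13Params p) j θ.A₁) with hT
  have hTm : MeasurableSet T := MeasurableSet.univ_pi fun _ => Metric.isOpen_ball.measurableSet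
  refine ⟨T.indicator 1, measurable_one.indicator hTm, ?_, fun ω => ?_⟩
  · rw [lintegral_indicator_one hTm]
    exact pi_ballBox_ne_top (ι := ↥B) (0 : FluctV N) _
  · by_cases ha : (fun b : ↥B => (ω j).2 b) ∈ T
    · rw [Set.indicator_of_mem ha, Pi.one_apply, ← ENNReal.ofReal_one]
      refine ENNReal.ofReal_le_ofReal ?_
      rw [w_WtOfRecord₁₃H_apply]
      have h1 : Real.exp (-(1 / 2 : ℝ) * (θ.zhAt p s).quad j (s.init.Λ (j + 1)) ω) ≤ 1 := Real.exp_le_one_iff.mpr (by nlinarith [hq ω])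
      calc chiAW F N (FluctV N) θ.ν θ.A₁ p (gOfRecord₁₃ F N θ.toStage13Params p) j Y ∅ ω * Real.exp (-(1 / 2 : ℝ) * (θ.zhAt p s).quad j (s.init.Λ (j + 1)) ω)
          ≤ 1 * 1 := mul_le_mul (chiAW_le_one _ _ _ _) h1 (Real.exp_nonneg _) zero_le_one
        _ = 1 := one_mul 1
    · rw [Set.indicator_of_notMem ha]
      obtain ⟨b, hb⟩ : ∃ b : ↥B, ¬ ‖(ω j).2 (b : PBond (F.P p.K) j)‖ < deltaOfRecord θ.ν (gOfRecord₁₃ F N θ.toStage13Params p) j θ.A₁ := by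
        by_contra hall
        push Not at hall
        exact ha (Set.mem_univ_pi.mpr fun b => by rw [Metric.mem_ball, dist_zero_right]; exact hall b)
      have hbY : (b : PBond (F.P p.K) j) ∈ bondsIn j Y := by rw [← Set.Finite.mem_toFinset]; exact b.2
      obtain ⟨c, hc, hbc⟩ := hcov b hbY
      have hχ : chiSmallAW F N (FluctV N) θ.ν θ.A₁ p (gOfRecord₁₃ F N θ.toStage13Params p) j
          (cubesIn (cubeχ F θ.ν p (gOfRecord₁₃ F N θ.toStage13Params p) j) Y) ω = 0 := by
        rw [chiSmallAW_eq_ite, if_neg]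
        exact fun hsmall => hb (hsmall c hc b hbc)
      rw [w_WtOfRecord₁₃H_apply, chiAW_empty_eq_chiSmallAW, hχ, zero_mul, ENNReal.ofReal_zero]

/-- **★★ THE ROW FOR THE ALL-SMALL BRANCH VALUE AT THE CERTIFICATE FROM THE COVERING** (`rePinH θ`: `quad ≡ 0`, so [I]'s sign holds trivially): dag-n11-d's NEXT (n2)
with the covering DISPLAYED — it is not a property of every history (§3: thin regions violate it), it IS one of every region that is a union of ∼2-star-covered χ_{j+1}-cubes.
[cite: Balaban1988Convergent, (3.16) p.268, (3.21) p.269, (2.21) p.258, (3.23) p.270] -/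
theorem afibre_dominated_rePinH_of_cover {k : ℕ} (s : SeqOfRecord F θ.ν θ.τ9.M (gOfRecord₁₃ F N θ.toStage13Params p) p.K (k + 1)) (j : ℕ)
    (hcov : ∀ b ∈ bondsIn j ((s.init.Λ (j + 1))ᶜ ∩ s.init.Ω (j + 1)),
      ∃ c ∈ cubesIn (cubeχ F θ.ν p (gOfRecord₁₃ F N θ.toStage13Params p) j) ((s.init.Λ (j + 1))ᶜ ∩ s.init.Ω (j + 1)),
        b ∈ bondsStarW F θ.ν p (gOfRecord₁₃ F N θ.toStage13Params p) j c)
    (S : ℕ → Set (Site (F.P p.K) 0)) (hS : S (j + 1) = ∅) :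
    ∃ ŵ : (↥(Set.toFinite (bondsIn j ((s.init.Λ (j + 1))ᶜ ∩ s.init.Ω (j + 1)))).toFinset → FluctV N) → ℝ≥0∞, Measurable ŵ ∧
      (∫⁻ a, ŵ a ∂(Measure.pi fun _ : ↥(Set.toFinite (bondsIn j ((s.init.Λ (j + 1))ᶜ ∩ s.init.Ω (j + 1)))).toFinset => (volume : Measure (FluctV N)))) ≠ ⊤ ∧
      ∀ ω, ENNReal.ofReal ((WtOfRecord₁₃H F N (rePinH θ) p s).w j (s.init.Λ (j + 1)) ((s.init.Λ (j + 1))ᶜ ∩ s.init.Ω (j + 1)) (S (j + 1)) ω) ≤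
        ŵ (fun b : ↥(Set.toFinite (bondsIn j ((s.init.Λ (j + 1))ᶜ ∩ s.init.Ω (j + 1)))).toFinset => (ω j).2 b) :=
  afibre_dominated_of_cover_of_quad_nonneg (rePinH θ) p s j (fun ω => (zhAt_rePinH_quad θ p s j _ ω).ge) hcov S hS

end Cover

/-! ## §2  ★ At the certificate on the no-large-field sub-diagonal: one-point fibres, the row holds for every branch -/

section NoLargeField

variable (θ : Stage13HParams F N) (p : B12.RunParams)

/-- Along a history with NO retained large-field region below the top (`Λ_i = Ω_i` for `1 ≤ i ≤ k`) every region `Λ_{j+1}(init s′)ᶜ ∩ Ω_{j+1}(init s′)` is empty.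
[cite: Balaban1988Convergent, (2.1) p.254 (bookkeeping)] -/
theorem region_init_eq_empty_of_noLargeField {k : ℕ} (s : SeqOfRecord F θ.ν θ.τ9.M (gOfRecord₁₃ F N θ.toStage13Params p) p.K (k + 1))
    (hΛ : ∀ i, 1 ≤ i → i ≤ k → s.Λ i = s.Ω i) (j : ℕ) : (s.init.Λ (j + 1))ᶜ ∩ s.init.Ω (j + 1) = ∅ := by
  by_cases hj : j + 1 ≤ k
  · rw [seq_init_Λ_of_le s hj, seq_init_Ω_of_le s hj, hΛ (j + 1) (Nat.succ_pos j) hj, Set.compl_inter_self]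
  · rw [s.init.Ω_off (j + 1) (fun h => hj h.2), Set.inter_empty]

/-- … so its level-`j` bond set is empty. [cite: Balaban1988Convergent, (2.1) p.254, (2.21) p.258 (bookkeeping)] -/
theorem bonds_init_eq_empty_of_noLargeField {k : ℕ} (s : SeqOfRecord F θ.ν θ.τ9.M (gOfRecord₁₃ F N θ.toStage13Params p) p.K (k + 1))
    (hΛ : ∀ i, 1 ≤ i → i ≤ k → s.Λ i = s.Ω i) (j : ℕ) : (Set.toFinite (bondsIn j ((s.init.Λ (j + 1))ᶜ ∩ s.init.Ω (j + 1)))).toFinset = ∅ := by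
  refine Finset.eq_empty_iff_forall_notMem.mpr fun b hb => ?_
  rw [Set.Finite.mem_toFinset, region_init_eq_empty_of_noLargeField θ p s hΛ j] at hb
  exact hb.1

/-- **★ THE ROW AT THE CERTIFICATE ON THE NO-LARGE-FIELD SUB-DIAGONAL, EVERY BRANCH, EVERY GENERATION**: at `rePinH θ` (`quad ≡ 0`, so `w = χ_A ≤ 1`), along a
history `s′` of length `k+1` with `Λ_i(s′) = Ω_i(s′)` for `1 ≤ i ≤ k` (no large-field region retained below the top; dag-n11-d's all-large diagonal `Ω ≡ ∅` is the
case `Ω_i = ∅`), the A-fibre of every generation is a ONE-POINT space and `ŵ := 1` (mass `1`) dominates — the (K0b) row of `…N11OldBranchIntegrableOfDominated` §4 ∕ of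
dag-n11-e's `hrows` holds there for every `S` (not only `S ∈ admSOfRecord`) and every `j`, under the history-indexed residual law `zhLaws` of `θ` (for `χ_A ≥ 0` one needs
nothing; for `w ≤ 1` the laws).  Generalises the first conjunct of their `rows_of_allLarge`. [cite: Balaban1988Convergent, (2.21) p.258, (2.1) p.254, (3.23) p.270] -/
theorem rows_rePinH_of_noLargeField (h : θ.Provisos₁₃CoPH F N) {k : ℕ}
    (s : SeqOfRecord F θ.ν θ.τ9.M (gOfRecord₁₃ F N θ.toStage13Params p) p.K (k + 1)) (hΛ : ∀ i, 1 ≤ i → i ≤ k → s.Λ i = s.Ω i)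
    (S : ℕ → Set (Site (F.P p.K) 0)) (j : ℕ) :
    ∃ ŵ : (↥(Set.toFinite (bondsIn j ((s.init.Λ (j + 1))ᶜ ∩ s.init.Ω (j + 1)))).toFinset → FluctV N) → ℝ≥0∞, Measurable ŵ ∧
      (∫⁻ a, ŵ a ∂(Measure.pi fun _ : ↥(Set.toFinite (bondsIn j ((s.init.Λ (j + 1))ᶜ ∩ s.init.Ω (j + 1)))).toFinset => (volume : Measure (FluctV N)))) ≠ ⊤ ∧
      ∀ ω, ENNReal.ofReal ((WtOfRecord₁₃H F N (rePinH θ) p s).w j (s.init.Λ (j + 1)) ((s.init.Λ (j + 1))ᶜ ∩ s.init.Ω (j + 1)) (S (j + 1)) ω) ≤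
        ŵ (fun b : ↥(Set.toFinite (bondsIn j ((s.init.Λ (j + 1))ᶜ ∩ s.init.Ω (j + 1)))).toFinset => (ω j).2 b) := by
  have hWlaws : (WtOfRecord₁₃H F N (rePinH θ) p s).Laws := WtOfRecord₁₃H_laws (provisos₁₃CoPH_rePinH h).zhLaws p s
  haveI : IsEmpty ↥(Set.toFinite (bondsIn j ((s.init.Λ (j + 1))ᶜ ∩ s.init.Ω (j + 1)))).toFinset := by
    rw [bonds_init_eq_empty_of_noLargeField θ p s hΛ j]
    infer_instance
  refine ⟨fun _ => 1, measurable_const, ?_, fun ω => ?_⟩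
  · rw [lintegral_const, Measure.pi_empty_univ, mul_one]
    exact ENNReal.one_ne_top
  · rw [← ENNReal.ofReal_one]
    exact ENNReal.ofReal_le_ofReal (TkWeights.w_le_one hWlaws j _ _ _ ω le_rfl)

end NoLargeField

/-! ## §3  ★★ LOCATED NEGATIVE: at the certificate the row FAILS at every thin region (the Gaussian value is necessary there) -/

section Negative

variable (θ : Stage13HParams F N) (p : B12.RunParams)

/-- **THE A-WEIGHT OF THE ALL-SMALL BRANCH VALUE AT THE CERTIFICATE**: at `rePinH θ` and `S = ∅`, `w_j(Λ′, Y, ∅)(ω) = χ^{(j)}(χ_{j+1}-cubes ⊂ Y)(A_j)` — the (3.16)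
small-fluctuation indicator of the cubes inside `Y` ALONE (`quad ≡ 0`; `χ^{(j)c}(∅) = χ′(∅) = 1`). [cite: Balaban1988Convergent, (3.16) p.268, (3.21) p.269, (2.21) p.258] -/
theorem w_rePinH_empty_eq_chiSmallAW {n : ℕ} (s : SeqOfRecord F θ.ν θ.τ9.M (gOfRecord₁₃ F N θ.toStage13Params p) p.K n) (j : ℕ) (Λ' Y : Set (Site (F.P p.K) 0))
    (ω : MultiCfg (F.P p.K) (SU N) (FluctV N)) :
    (WtOfRecord₁₃H F N (rePinH θ) p s).w j Λ' Y ∅ ω =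
      chiSmallAW F N (FluctV N) θ.ν θ.A₁ p (gOfRecord₁₃ F N θ.toStage13Params p) j (cubesIn (cubeχ F θ.ν p (gOfRecord₁₃ F N θ.toStage13Params p) j) Y) ω := by
  have h := w_WtOfRecord₁₃H_apply (rePinH θ) p s j Λ' Y ∅ ω
  rw [zhAt_rePinH_quad, mul_zero, Real.exp_zero, mul_one] at h
  rw [h]
  exact chiAW_empty_eq_chiSmallAW θ p (gOfRecord₁₃ F N θ.toStage13Params p) j Y ω

/-- **★★ LOCATED NEGATIVE — AN UNCOVERED BOND KILLS THE ROW AT THE CERTIFICATE**: at `rePinH θ`, `N ≥ 2`, `δ_j > 0` (print's sign), `S_{j+1} = ∅`: if `Y_j` carries a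
level-`j` bond `b₀` lying in the `∼2`-star of NO χ_{j+1}-cube `c ⊂ Y_j`, then NO measurable `ŵ` of finite product-Lebesgue mass dominates `w_j(Λ_{j+1}, Y_j, ∅)` through
`A_j|_{B_j}`: on the box `{a : ‖a b‖ < δ_j at the covered bonds}` (infinite mass: its `b₀`-side is all of `𝔰𝔲(N)`) the weight has a section identically `1` (extend `a` by `0`;
every star bond is then `δ_j`-small).  Print's (2.21) exponent carries `−½⟨A_j, C*Δ^{(j)}CA_j⟩` there; the certificate's `quad ≡ 0` does not.
[cite: Balaban1988Convergent, (2.21) p.258, (3.16) p.268, (3.21) p.269, (3.23) p.270] -/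
theorem not_afibre_dominated_rePinH_of_uncovered (hN : 2 ≤ N) {k : ℕ}
    (s : SeqOfRecord F θ.ν θ.τ9.M (gOfRecord₁₃ F N θ.toStage13Params p) p.K (k + 1)) (j : ℕ)
    (hδ : 0 < deltaOfRecord θ.ν (gOfRecord₁₃ F N θ.toStage13Params p) j θ.A₁)
    {b₀ : PBond (F.P p.K) j} (hb₀ : b₀ ∈ bondsIn j ((s.init.Λ (j + 1))ᶜ ∩ s.init.Ω (j + 1)))
    (hunc : ∀ c ∈ cubesIn (cubeχ F θ.ν p (gOfRecord₁₃ F N θ.toStage13Params p) j) ((s.init.Λ (j + 1))ᶜ ∩ s.init.Ω (j + 1)),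
      b₀ ∉ bondsStarW F θ.ν p (gOfRecord₁₃ F N θ.toStage13Params p) j c)
    (S : ℕ → Set (Site (F.P p.K) 0)) (hS : S (j + 1) = ∅) :
    ¬ ∃ ŵ : (↥(Set.toFinite (bondsIn j ((s.init.Λ (j + 1))ᶜ ∩ s.init.Ω (j + 1)))).toFinset → FluctV N) → ℝ≥0∞, Measurable ŵ ∧
      (∫⁻ a, ŵ a ∂(Measure.pi fun _ : ↥(Set.toFinite (bondsIn j ((s.init.Λ (j + 1))ᶜ ∩ s.init.Ω (j + 1)))).toFinset => (volume : Measure (FluctV N)))) ≠ ⊤ ∧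
      ∀ ω, ENNReal.ofReal ((WtOfRecord₁₃H F N (rePinH θ) p s).w j (s.init.Λ (j + 1)) ((s.init.Λ (j + 1))ᶜ ∩ s.init.Ω (j + 1)) (S (j + 1)) ω) ≤
        ŵ (fun b : ↥(Set.toFinite (bondsIn j ((s.init.Λ (j + 1))ᶜ ∩ s.init.Ω (j + 1)))).toFinset => (ω j).2 b) := by
  classical
  rw [hS]
  set Y := (s.init.Λ (j + 1))ᶜ ∩ s.init.Ω (j + 1) with hY
  set B := (Set.toFinite (bondsIn j Y)).toFinset with hB
  let Cov : PBond (F.P p.K) j → Prop := fun b =>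
    ∃ c ∈ cubesIn (cubeχ F θ.ν p (gOfRecord₁₃ F N θ.toStage13Params p) j) Y, b ∈ bondsStarW F θ.ν p (gOfRecord₁₃ F N θ.toStage13Params p) j c
  let t : ↥B → Set (FluctV N) := fun b =>
    if Cov b then Metric.ball 0 (deltaOfRecord θ.ν (gOfRecord₁₃ F N θ.toStage13Params p) j θ.A₁) else Set.univ
  have hb₀B : b₀ ∈ B := by rw [hB, Set.Finite.mem_toFinset]; exact hb₀
  have hnc₀ : ¬ Cov b₀ := fun ⟨c, hc, hb⟩ => hunc c hc hb
  refine not_exists_dominating_of_section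
    (fun ω : MultiCfg (F.P p.K) (SU N) (FluctV N) => (WtOfRecord₁₃H F N (rePinH θ) p s).w j (s.init.Λ (j + 1)) Y ∅ ω)
    (fun ω (b : ↥B) => (ω j).2 b) (T := Set.pi Set.univ t) (MeasurableSet.univ_pi fun b => ?_) ?_ ?_
  · by_cases hb : Cov b
    · simp only [t, if_pos hb]; exact Metric.isOpen_ball.measurableSet
    · simp only [t, if_neg hb]; exact MeasurableSet.univ
  · refine pi_box_eq_top t (i₀ := ⟨b₀, hb₀B⟩) ?_ fun b => ?_
    · simp only [t, if_neg hnc₀]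
      exact volume_fluctV_univ hN
    · by_cases hb : Cov b
      · simp only [t, if_pos hb]
        exact (Metric.isOpen_ball.measure_ne_zero volume ⟨0, Metric.mem_ball_self hδ⟩)
      · simp only [t, if_neg hb]
        rw [volume_fluctV_univ hN]
        exact ENNReal.top_ne_zero
  · intro a ha
    let A : VecField (F.P p.K) j (FluctV N) := fun b => if hb : b ∈ B then a ⟨b, hb⟩ else 0
    let ω : MultiCfg (F.P p.K) (SU N) (FluctV N) := Function.update (fun i => ((fun _ => 1), (fun _ => 0))) j ((fun _ => 1), A)
    have hωj : (ω j).2 = A := by simp only [ω, Function.update_self]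
    refine ⟨ω, ?_, ?_⟩
    · funext b
      rw [hωj]
      simp only [A, dif_pos b.2]
    · rw [w_rePinH_empty_eq_chiSmallAW, chiSmallAW_eq_ite, if_pos]
      intro c hc b hb
      rw [hωj]
      by_cases hbB : b ∈ B
      · have hcov : Cov b := ⟨c, hc, hb⟩
        have hab := ha ⟨b, hbB⟩ (Set.mem_univ _)
        simp only [t, if_pos hcov, Metric.mem_ball, dist_zero_right] at hab
        simp only [A, dif_pos hbB]
        exact hab
      · simp only [A, dif_neg hbB, norm_zero]
        exact hδ

/-- **★★ LOCATED NEGATIVE — A REGION WITHOUT χ-CUBES KILLS THE ROW AT THE CERTIFICATE** (no sign hypothesis): at `rePinH θ`, `N ≥ 2`, for `S_{j+1} = ∅`: if `Y_j` contains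
NO χ_{j+1}-cube but carries a level-`j` bond, the weight `w_j(Λ_{j+1}, Y_j, ∅)` is IDENTICALLY `1` (empty product (3.16)) and no integrable majorant exists (the fibre
`⊗_{B_j} Lebesgue` has infinite mass).  This is the case of every region one 𝐃_{j+1}-cube thick when `M < L·M₂` (side `L^{j+1}MR_{j+1}` < `L^{j+2}M₂R_{j+1}`), e.g. at
the witness of record (`M = 1`). [cite: Balaban1988Convergent, (2.1) p.254, (2.21) p.258, (3.16) p.268, (3.21) p.269] -/
theorem not_afibre_dominated_rePinH_of_noCube (hN : 2 ≤ N) {k : ℕ}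
    (s : SeqOfRecord F θ.ν θ.τ9.M (gOfRecord₁₃ F N θ.toStage13Params p) p.K (k + 1)) (j : ℕ)
    (hno : cubesIn (cubeχ F θ.ν p (gOfRecord₁₃ F N θ.toStage13Params p) j) ((s.init.Λ (j + 1))ᶜ ∩ s.init.Ω (j + 1)) = ∅)
    (hne : (bondsIn j ((s.init.Λ (j + 1))ᶜ ∩ s.init.Ω (j + 1))).Nonempty)
    (S : ℕ → Set (Site (F.P p.K) 0)) (hS : S (j + 1) = ∅) :
    ¬ ∃ ŵ : (↥(Set.toFinite (bondsIn j ((s.init.Λ (j + 1))ᶜ ∩ s.init.Ω (j + 1)))).toFinset → FluctV N) → ℝ≥0∞, Measurable ŵ ∧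
      (∫⁻ a, ŵ a ∂(Measure.pi fun _ : ↥(Set.toFinite (bondsIn j ((s.init.Λ (j + 1))ᶜ ∩ s.init.Ω (j + 1)))).toFinset => (volume : Measure (FluctV N)))) ≠ ⊤ ∧
      ∀ ω, ENNReal.ofReal ((WtOfRecord₁₃H F N (rePinH θ) p s).w j (s.init.Λ (j + 1)) ((s.init.Λ (j + 1))ᶜ ∩ s.init.Ω (j + 1)) (S (j + 1)) ω) ≤
        ŵ (fun b : ↥(Set.toFinite (bondsIn j ((s.init.Λ (j + 1))ᶜ ∩ s.init.Ω (j + 1)))).toFinset => (ω j).2 b) := by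
  classical
  rw [hS]
  set Y := (s.init.Λ (j + 1))ᶜ ∩ s.init.Ω (j + 1) with hY
  set B := (Set.toFinite (bondsIn j Y)).toFinset with hB
  obtain ⟨b₀, hb₀⟩ := hne
  have hb₀B : b₀ ∈ B := by rw [hB, Set.Finite.mem_toFinset]; exact hb₀
  refine not_exists_dominating_of_section
    (fun ω : MultiCfg (F.P p.K) (SU N) (FluctV N) => (WtOfRecord₁₃H F N (rePinH θ) p s).w j (s.init.Λ (j + 1)) Y ∅ ω)
    (fun ω (b : ↥B) => (ω j).2 b) (T := Set.pi Set.univ fun _ => Set.univ) (MeasurableSet.univ_pi fun _ => MeasurableSet.univ) ?_ ?_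
  · refine pi_box_eq_top (fun _ : ↥B => (Set.univ : Set (FluctV N))) (i₀ := ⟨b₀, hb₀B⟩) (volume_fluctV_univ hN) fun _ => ?_
    rw [volume_fluctV_univ hN]
    exact ENNReal.top_ne_zero
  · intro a _
    let A : VecField (F.P p.K) j (FluctV N) := fun b => if hb : b ∈ B then a ⟨b, hb⟩ else 0
    let ω : MultiCfg (F.P p.K) (SU N) (FluctV N) := Function.update (fun i => ((fun _ => 1), (fun _ => 0))) j ((fun _ => 1), A)
    have hωj : (ω j).2 = A := by simp only [ω, Function.update_self]
    refine ⟨ω, ?_, ?_⟩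
    · funext b
      rw [hωj]
      simp only [A, dif_pos b.2]
    · rw [w_rePinH_empty_eq_chiSmallAW, hno, chiSmallAW_eq_ite, if_pos (by simp)]

/-- **★★ HENCE THE ROW FAMILY OF THE SPECIFICATION IS UNSATISFIABLE AT THE CERTIFICATE AT SUCH A HISTORY**: at `rePinH θ`, `N ≥ 2`, if some generation's region
`Λ_{j+1}(init s′)ᶜ ∩ Ω_{j+1}(init s′)` contains no χ_{j+1}-cube but a bond, then `∀ S ∈ admSOfRecord(init s′), ∀ j, ∃ ŵ …` — the (K0b) hypothesis of dag-n11-d's ★★★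
`exists_local_witness_clause_succ_rePinH_of_sLaw₁₃CoPH_of_dominated` and of dag-n11-e's `noExpansionTStepAt_rePinH_of_dominated_rows` at `s′` — FAILS (the all-empty
branch is always an index).  So at the certificate door (d3) reaches exactly the histories without free bonds; elsewhere the VALUE of `Zh.quad` must carry [I]'s
Gaussian (§1).  A statement about the typed certificate, not about print. [cite: Balaban1988Convergent, (2.1) p.254, (2.21) p.258, (3.16) p.268, (3.23) p.270] -/
theorem not_rows_rePinH_of_noCube (hN : 2 ≤ N) {k : ℕ}
    (s : SeqOfRecord F θ.ν θ.τ9.M (gOfRecord₁₃ F N θ.toStage13Params p) p.K (k + 1)) (j : ℕ)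
    (hno : cubesIn (cubeχ F θ.ν p (gOfRecord₁₃ F N θ.toStage13Params p) j) ((s.init.Λ (j + 1))ᶜ ∩ s.init.Ω (j + 1)) = ∅)
    (hne : (bondsIn j ((s.init.Λ (j + 1))ᶜ ∩ s.init.Ω (j + 1))).Nonempty) :
    ¬ ∀ S ∈ admSOfRecord F θ.ν θ.τ9.M (gOfRecord₁₃ F N θ.toStage13Params p) p.K k s.init, ∀ j : ℕ,
      ∃ ŵ : (↥(Set.toFinite (bondsIn j ((s.init.Λ (j + 1))ᶜ ∩ s.init.Ω (j + 1)))).toFinset → FluctV N) → ℝ≥0∞, Measurable ŵ ∧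
        (∫⁻ a, ŵ a ∂(Measure.pi fun _ : ↥(Set.toFinite (bondsIn j ((s.init.Λ (j + 1))ᶜ ∩ s.init.Ω (j + 1)))).toFinset => (volume : Measure (FluctV N)))) ≠ ⊤ ∧
        ∀ ω, ENNReal.ofReal ((WtOfRecord₁₃H F N (rePinH θ) p s).w j (s.init.Λ (j + 1)) ((s.init.Λ (j + 1))ᶜ ∩ s.init.Ω (j + 1)) (S (j + 1)) ω) ≤
          ŵ (fun b : ↥(Set.toFinite (bondsIn j ((s.init.Λ (j + 1))ᶜ ∩ s.init.Ω (j + 1)))).toFinset => (ω j).2 b) := by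
  intro hrows
  have hmem : (fun _ => (∅ : Set (Site (F.P p.K) 0))) ∈ admSOfRecord F θ.ν θ.τ9.M (gOfRecord₁₃ F N θ.toStage13Params p) p.K k s.init :=
    const_empty_mem_admSSeq _ (empty_mem_SClassOfRecord F θ.ν _ p.K) s.init
  exact not_afibre_dominated_rePinH_of_noCube θ p hN s j hno hne (fun _ => ∅) rfl (hrows _ hmem j)

end Negative

/-! ## §4  ★★★ At print's sign `δ_j > 0` the row at the certificate for the all-small branch value IS the covering -/

section Iff

variable (θ : Stage13HParams F N) (p : B12.RunParams)

/-- **★★★ THE DICHOTOMY AT THE CERTIFICATE**: at `rePinH θ`, `N ≥ 2`, `δ_j > 0`, branch value `S_{j+1} = ∅`, the A-fibre domination row of generation `j` at the history `s′`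
HOLDS IF AND ONLY IF every level-`j` bond of `Y_j = Λ_{j+1}(init s′)ᶜ ∩ Ω_{j+1}(init s′)` lies in the `∼2`-star of some χ_{j+1}-cube contained in `Y_j` (§1 ⟸; §3 ⟹).  So at the
certificate dag-n11-d's door (d3) reaches, on the all-small branch, EXACTLY the star-covered regions; at every other region the VALUE of `Zh.quad` must be [I]'s Gaussian
(dag-n11-w4's coercivity supplier `…N11AFibreDominationOfCoercive`). [cite: Balaban1988Convergent, (2.21) p.258, (3.16) p.268, (3.21) p.269, (3.23) p.270] -/
theorem afibre_dominated_rePinH_iff_cover (hN : 2 ≤ N) {k : ℕ}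
    (s : SeqOfRecord F θ.ν θ.τ9.M (gOfRecord₁₃ F N θ.toStage13Params p) p.K (k + 1)) (j : ℕ)
    (hδ : 0 < deltaOfRecord θ.ν (gOfRecord₁₃ F N θ.toStage13Params p) j θ.A₁)
    (S : ℕ → Set (Site (F.P p.K) 0)) (hS : S (j + 1) = ∅) :
    (∃ ŵ : (↥(Set.toFinite (bondsIn j ((s.init.Λ (j + 1))ᶜ ∩ s.init.Ω (j + 1)))).toFinset → FluctV N) → ℝ≥0∞, Measurable ŵ ∧
      (∫⁻ a, ŵ a ∂(Measure.pi fun _ : ↥(Set.toFinite (bondsIn j ((s.init.Λ (j + 1))ᶜ ∩ s.init.Ω (j + 1)))).toFinset => (volume : Measure (FluctV N)))) ≠ ⊤ ∧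
      ∀ ω, ENNReal.ofReal ((WtOfRecord₁₃H F N (rePinH θ) p s).w j (s.init.Λ (j + 1)) ((s.init.Λ (j + 1))ᶜ ∩ s.init.Ω (j + 1)) (S (j + 1)) ω) ≤
        ŵ (fun b : ↥(Set.toFinite (bondsIn j ((s.init.Λ (j + 1))ᶜ ∩ s.init.Ω (j + 1)))).toFinset => (ω j).2 b)) ↔
    ∀ b ∈ bondsIn j ((s.init.Λ (j + 1))ᶜ ∩ s.init.Ω (j + 1)),
      ∃ c ∈ cubesIn (cubeχ F θ.ν p (gOfRecord₁₃ F N θ.toStage13Params p) j) ((s.init.Λ (j + 1))ᶜ ∩ s.init.Ω (j + 1)),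
        b ∈ bondsStarW F θ.ν p (gOfRecord₁₃ F N θ.toStage13Params p) j c := by
  refine ⟨fun h => ?_, fun hcov => afibre_dominated_rePinH_of_cover θ p s j hcov S hS⟩
  by_contra hunc
  push Not at hunc
  obtain ⟨b₀, hb₀, hb₀unc⟩ := hunc
  exact not_afibre_dominated_rePinH_of_uncovered θ p hN s j hδ hb₀ hb₀unc S hS h

end Iff

end Summit.QuantumFields.YangMills.Theorems.BalabanUVNodesN11AFibreDominationRow

end
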